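import Literature.InformationTheory.QuantumCodes.TwoBlockOrbitReduction
import HarnessLib

/-!
# Translation-pinned distance certificates for bivariate-bicycle codes in FLAT indices

Companion to `TwoBlockOrbitReduction.lean` (the translation-orbit lemma for `QC(A, B)`:
every `Z`-logical may be replaced by one of the same weight with
`v (inl 0) ≠ 0 ∨ ((∀ x, v (inl x) = 0) ∧ v (inr 0) ≠ 0)`) and to the flat-index bridge of
`BivariateBicycleCodes.lean` (`BB.Code.HXFlat/HZFlat/cssFlat` on `Fin (ℓm)` checks × `Fin (ℓm + ℓm)`
qubits, `qubitIndex : (L,(a,b)) ↦ a·m+b, (R,(a,b)) ↦ ℓm + a·m+b` — the LADDER-QEC CERT-FORMAT §index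
convention).  Here the pinning disjunction is transported to flat vectors
`u : Fin (ℓm + ℓm) → 𝔽₂`: "bit `0` set, or bits `0 … ℓm−1` clear and bit `ℓm` set"
(`qubitIndex_inl_zero_val`, `qubitIndex_inr_zero_val`, `forall_inl_eq_zero_iff`,
`exists_zLogicalFlat_pinned`), and the certificate lemma a checker on flat bitmask rows discharges:
**`d_eq_of_pinned_witness_flat`** — an explicit flat `Z`-logical of weight `d` plus "every PINNED flat
`Z`-logical has weight `≥ d`" gives `C.d = d` (and `C.cssFlat.dZ = d`, `C.css.dZ = d`:
`cssFlat_dZ_eq_of_pinned_witness_flat`).  This is the Lean side of the «assumes: TranslationOrbit»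
hypothesis of translation-pinned `[[72,12,6]]` / `[[144,12,12]]` certificates (kernel-B enc-v2 cases
"qubit 0 ∈ supp" / "supp ⊆ R ∧ qubit ℓm ∈ supp"; kernel-A `mitm_sym`), now a theorem.

Everything here is PROVED; no named facts, no definitions.

## References
* [BravyiEtAl2024] S. Bravyi et al., Nature 627 (2024) 778–782 = arXiv:2308.07915, §4 (index
  convention, `H^X = [A|B]`; held text chunk p0009 L16, L28–31), Lemma 1 (p0009 L74–77) and
  Supplementary Information §9.2 (automorphisms; p0021 L60 – p0022 L12).

## Tree search (2026-08-26)
Reused: `BB.Code.qubitIndex`, `qubitIndex_inl_val`, `qubitIndex_inr_val`, `HXFlat_mulVec_eq_zero_iff`,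
`mem_rowSpace_HZFlat_iff`, `cssFlat_dZ`, `d_eq_dZ`, `BB.hammingNorm_comp_equiv`
(`BivariateBicycleCodes.lean`); `BB.Code.exists_zLogical_pinned`, `d_eq_of_pinned_witness`
(`TwoBlockOrbitReduction.lean`); `hammingNorm_comp_equiv` (`HypergraphProductKernels.lean`).
-/

namespace Literature.InformationTheory.QuantumCodes.BB.Code

open Matrix

variable {ℓ m : ℕ} [NeZero ℓ] [NeZero m] (C : Code ℓ m)

/-- The base qubit of block `L` has flat index `0`: `qubitIndex (L, (0,0)) = 0`.
[cite: BravyiEtAl2024, §4 (arXiv:2308.07915 chunk p0009 L16 and L28–31: block L = columns 0 … ℓm−1)] -/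
theorem qubitIndex_inl_zero_val :
    ((qubitIndex (Sum.inl (0 : Mono ℓ m)) : Fin (ℓ * m + ℓ * m)) : ℕ) = 0 := by
  show ((qubitIndex (Sum.inl ((0 : Fin ℓ), (0 : Fin m))) : Fin (ℓ * m + ℓ * m)) : ℕ) = 0
  rw [qubitIndex_inl_val]
  simp

/-- The base qubit of block `R` has flat index `ℓm`: `qubitIndex (R, (0,0)) = ℓm`.
[cite: BravyiEtAl2024, §4 (arXiv:2308.07915 chunk p0009 L16 and L28–31: block R = columns ℓm … 2ℓm−1)] -/
theorem qubitIndex_inr_zero_val :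
    ((qubitIndex (Sum.inr (0 : Mono ℓ m)) : Fin (ℓ * m + ℓ * m)) : ℕ) = ℓ * m := by
  show ((qubitIndex (Sum.inr ((0 : Fin ℓ), (0 : Fin m))) : Fin (ℓ * m + ℓ * m)) : ℕ) = ℓ * m
  rw [qubitIndex_inr_val]
  simp

omit [NeZero ℓ] [NeZero m] in
/-- Left-block qubits have flat index `< ℓm`. [cite: BravyiEtAl2024, §4 (arXiv:2308.07915 chunk p0009 L16 and L28–31)] -/
theorem qubitIndex_inl_val_lt (x : Mono ℓ m) :
    ((qubitIndex (Sum.inl x) : Fin (ℓ * m + ℓ * m)) : ℕ) < ℓ * m := by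
  obtain ⟨a, b⟩ := x
  rw [qubitIndex_inl_val]
  exact (finProdFinEquiv (a, b)).isLt.trans_eq' (by simp [finProdFinEquiv, mul_comm, add_comm])

omit [NeZero ℓ] [NeZero m] in
/-- Right-block qubits have flat index `≥ ℓm`. [cite: BravyiEtAl2024, §4 (arXiv:2308.07915 chunk p0009 L16 and L28–31)] -/
theorem le_qubitIndex_inr_val (x : Mono ℓ m) :
    ℓ * m ≤ ((qubitIndex (Sum.inr x) : Fin (ℓ * m + ℓ * m)) : ℕ) := by
  obtain ⟨a, b⟩ := x
  rw [qubitIndex_inr_val]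
  exact Nat.le_add_right _ _

omit [NeZero ℓ] [NeZero m] in
/-- "`u` vanishes on block `L`" in flat indices: `u (qubitIndex (L, x)) = 0` for all `x` iff `u i = 0`
for every flat index `i < ℓm`. [cite: BravyiEtAl2024, §4 (arXiv:2308.07915 chunk p0009 L16 and L28–31)] -/
theorem forall_inl_eq_zero_iff {K : Type*} [Zero K] (u : Fin (ℓ * m + ℓ * m) → K) :
    (∀ x : Mono ℓ m, u (qubitIndex (Sum.inl x)) = 0) ↔
      ∀ i : Fin (ℓ * m + ℓ * m), (i : ℕ) < ℓ * m → u i = 0 := by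
  constructor
  · intro h i hi
    obtain ⟨q, rfl⟩ := qubitIndex.surjective i
    rcases q with x | x
    · exact h x
    · exact absurd hi (not_lt.2 (le_qubitIndex_inr_val x))
  · intro h x
    exact h _ (qubitIndex_inl_val_lt x)

/-- **Translation-orbit lemma for `QC(A, B)` in flat indices, `Z`-side**: every `u` with
`HXFlat u = 0`, `u ∉ rs HZFlat` may be replaced by one of the same weight with
`u (qubitIndex (L,0)) ≠ 0 ∨ ((∀ i < ℓm, u i = 0) ∧ u (qubitIndex (R,0)) ≠ 0)` — i.e. bit `0` set, or the
left block clear and bit `ℓm` set (`qubitIndex_inl_zero_val`, `qubitIndex_inr_zero_val`).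
[cite: BravyiEtAl2024, SI §9.2 (arXiv:2308.07915, chunk p0021 L60 – p0022 L12)] -/
theorem exists_zLogicalFlat_pinned {u : Fin (ℓ * m + ℓ * m) → ZMod 2} (hu : C.HXFlat *ᵥ u = 0)
    (hu' : u ∉ rowSpace C.HZFlat) :
    ∃ u' : Fin (ℓ * m + ℓ * m) → ZMod 2, C.HXFlat *ᵥ u' = 0 ∧ u' ∉ rowSpace C.HZFlat ∧
      hammingNorm u' = hammingNorm u ∧
      (u' (qubitIndex (Sum.inl 0)) ≠ 0 ∨
        ((∀ i : Fin (ℓ * m + ℓ * m), (i : ℕ) < ℓ * m → u' i = 0) ∧ u' (qubitIndex (Sum.inr 0)) ≠ 0)) := by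
  have hv : C.HX *ᵥ (u ∘ qubitIndex) = 0 := (C.HXFlat_mulVec_eq_zero_iff u).1 hu
  have hv' : u ∘ qubitIndex ∉ rowSpace C.HZ := fun h => hu' ((C.mem_rowSpace_HZFlat_iff u).2 h)
  obtain ⟨v', h₁, h₂, hwt, hpin⟩ := C.exists_zLogical_pinned hv hv'
  have hcomp : (v' ∘ qubitIndex.symm) ∘ (qubitIndex (ℓ := ℓ) (m := m)) = v' := by
    funext q; simp
  refine ⟨v' ∘ qubitIndex.symm, ?_, ?_, ?_, ?_⟩
  · exact (C.HXFlat_mulVec_eq_zero_iff _).2 (by rw [hcomp]; exact h₁)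
  · intro h
    have h' := (C.mem_rowSpace_HZFlat_iff _).1 h
    rw [hcomp] at h'
    exact h₂ h'
  · rw [hammingNorm_comp_equiv v' qubitIndex.symm, hwt, ← BB.hammingNorm_comp_equiv u qubitIndex]
  · rw [← forall_inl_eq_zero_iff]
    simpa using hpin

/-- **Pinned certificate lemma for the distance of `QC(A, B)`, flat-index form**: an explicit flat
`Z`-logical `u` (`HXFlat u = 0`, `u ∉ rs HZFlat`) of weight `d`, plus "every flat `Z`-logical with bit `0`
set, or with the left block clear and bit `ℓm` set, has weight `≥ d`", gives `C.d = d` (and hence the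
`[[n,k,d]]` distance entry). [cite: BravyiEtAl2024, Lemma 1 and SI §9.2 (arXiv:2308.07915, chunk p0009 L74–77; p0021 L60 – p0022 L12)] -/
theorem d_eq_of_pinned_witness_flat {d : ℕ} {u : Fin (ℓ * m + ℓ * m) → ZMod 2}
    (hu : C.HXFlat *ᵥ u = 0) (hu' : u ∉ rowSpace C.HZFlat) (hwt : hammingNorm u = d)
    (h : ∀ w : Fin (ℓ * m + ℓ * m) → ZMod 2, C.HXFlat *ᵥ w = 0 → w ∉ rowSpace C.HZFlat →
      (w (qubitIndex (Sum.inl 0)) ≠ 0 ∨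
        ((∀ i : Fin (ℓ * m + ℓ * m), (i : ℕ) < ℓ * m → w i = 0) ∧ w (qubitIndex (Sum.inr 0)) ≠ 0)) →
      d ≤ hammingNorm w) :
    C.d = d := by
  have hv : C.HX *ᵥ (u ∘ qubitIndex) = 0 := (C.HXFlat_mulVec_eq_zero_iff u).1 hu
  have hv' : u ∘ qubitIndex ∉ rowSpace C.HZ := fun h' => hu' ((C.mem_rowSpace_HZFlat_iff u).2 h')
  refine C.d_eq_of_pinned_witness hv hv' (by rw [BB.hammingNorm_comp_equiv u qubitIndex, hwt]) ?_
  intro w hw hw' hpin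
  have hcomp : (w ∘ qubitIndex.symm) ∘ (qubitIndex (ℓ := ℓ) (m := m)) = w := by
    funext q; simp
  have h1 : C.HXFlat *ᵥ (w ∘ qubitIndex.symm) = 0 :=
    (C.HXFlat_mulVec_eq_zero_iff _).2 (by rw [hcomp]; exact hw)
  have h2 : w ∘ qubitIndex.symm ∉ rowSpace C.HZFlat := fun h' => by
    have h'' := (C.mem_rowSpace_HZFlat_iff _).1 h'
    rw [hcomp] at h''
    exact hw' h''
  have h3 := h _ h1 h2 (by rw [← forall_inl_eq_zero_iff]; simpa using hpin)
  rwa [hammingNorm_comp_equiv w qubitIndex.symm] at h3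

/-- The same certificate discharges `d^Z` of the flat CSS code `C.cssFlat` (the literal object a
checker on `Fin`-indexed bitmask rows builds) and of `C.css`.
[cite: BravyiEtAl2024, Lemma 1 and SI §9.2 (arXiv:2308.07915, chunk p0009 L74–77; p0021 L60 – p0022 L12)] -/
theorem cssFlat_dZ_eq_of_pinned_witness_flat {d : ℕ} {u : Fin (ℓ * m + ℓ * m) → ZMod 2}
    (hu : C.HXFlat *ᵥ u = 0) (hu' : u ∉ rowSpace C.HZFlat) (hwt : hammingNorm u = d)
    (h : ∀ w : Fin (ℓ * m + ℓ * m) → ZMod 2, C.HXFlat *ᵥ w = 0 → w ∉ rowSpace C.HZFlat →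
      (w (qubitIndex (Sum.inl 0)) ≠ 0 ∨
        ((∀ i : Fin (ℓ * m + ℓ * m), (i : ℕ) < ℓ * m → w i = 0) ∧ w (qubitIndex (Sum.inr 0)) ≠ 0)) →
      d ≤ hammingNorm w) :
    C.cssFlat.dZ = d ∧ C.css.dZ = d := by
  have hd := C.d_eq_of_pinned_witness_flat hu hu' hwt h
  rw [d_eq_dZ] at hd
  exact ⟨(C.cssFlat_dZ).trans hd, hd⟩

end Literature.InformationTheory.QuantumCodes.BB.Code
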